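import Literature.NumberTheory.Rogawski1990.LocalTransferFundamentalLemma
import Literature.NumberTheory.Automorphic.OrbitalMeasureFamilyRegular
import Literature.NumberTheory.Automorphic.UnitaryGroupArchTopology
import Literature.LinearAlgebra.Matrix.CentraliserOfSeparableCharpoly
import HarnessLib

/-!
# Archimedean orbital measures at the REGULAR classes of `U(H)(L⁺ ⊗ ℝ)` (Rogawski (1990), §14.2–14.3 pp. 232–234, §4.9 p. 54;
# Deitmar–Echterhoff (2014), Thm. 1.5.3)

Topic `NumberTheory/Rogawski1990` (archimedean twin of ★ `Automorphic/LocalOrbitalMeasureRegular` ∕ ★ `Rogawski1990/LocalTransferAdmissibleFamilies`;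
ENGINE T1 of the cell `hodgecm-mathlib`, line `F0_T1InnerFormTraceIdentity`, brick (m6)); namespace `Literature.NumberTheory.Rogawski1990`
(+ one generic lemma under `Literature.NumberTheory.Automorphic.UnitaryGroup`). THEOREMS ONLY (no definition, no named fact, no instance,
no notation).

The archimedean transfer relations ([Rogawski1990] (14.2.1) at `v ∈ S₀`, §14.3 p. 234) are stated with orbital measure families on the
real group `G′_∞ = U(H)(L⁺ ⊗ ℝ) = UnitaryGroup.arch L⁺ L c N H ≤ GL_N(L ⊗ ℝ)` (★ `UnitaryGroupArchimedean`, topological-group instances ★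
`UnitaryGroupArchTopology`) which must be NON-ZERO, INVARIANT and FINITE ON COMPACTS at the classes where the relations bite — the REGULAR
semisimple classes. As at the finite places (★ `LocalOrbitalMeasureRegular`), a regular element has a COMMUTATIVE centraliser, hence a
unimodular one, and the generic engine ★ `exists_orbitalMeasureFamily_of_forall_comm` produces the family once the AMBIENT group is unimodular.

* (private) the coordinate embedding `L ⊗ ℝ = ℝ^{r₁} × ℂ^{r₂} ↪ ℂ^{r₁ + r₂}` (a ring homomorphism into a product of fields, the hypothesis
  of ★ `Subgroup.mul_comm_of_mem_centralizer_of_charpoly_separable`);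
* `UnitaryGroup.centralizer_comm_of_isRegularElt_arch` — **a regular `γ ∈ U(H)(L⁺ ⊗ ℝ)` has a commutative centraliser**;
* `exists_isAdmissibleOn_isRegularElt_arch_of_unimodular` — **admissible archimedean orbital measures on the regular classes**, for every
  Borel structure on the orbit quotients, GIVEN unimodularity `Δ ≡ 1` of `U(H)(L⁺ ⊗ ℝ)` (a reductive Lie group — [Knapp2002, Cor. 8.31];
  the tree proves `Δ ≡ 1` for `GL_N(L ⊗ ℝ)` (★ `modularCharacter_eq_one_glInf`, Cartan decomposition) and has the Cartan decomposition of
  `U(p, q)` in the involutive frame (★ `unitaryFormGroup_hasCartanDecomposition`); the transport to `UnitaryGroup.arch` is the follow-up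
  brick «arch unimodularity», recorded here as the ONE hypothesis `hΔ`).

## References
* J. Rogawski, Ann. of Math. Stud. 123 (1990), §4.9 p. 54, §14.2–14.3 pp. 232–234 (print) [Rogawski1990].
* A. Deitmar, S. Echterhoff, *Principles of Harmonic Analysis*, 2nd ed. (2014), Thm. 1.5.3 [DeitmarEchterhoff2014].
* A. W. Knapp, *Lie Groups Beyond an Introduction*, 2nd ed. (2002), Cor. 8.31 [Knapp2002].
-/

set_option autoImplicit false

noncomputable section

open MeasureTheory Measure NumberField NumberField.InfinitePlace Polynomial
open scoped Matrix MatrixGroups NNReal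

namespace Literature.NumberTheory.Automorphic

namespace UnitaryGroup

open Literature.LinearAlgebra.Matrix Literature.NumberTheory.Rogawski1990

/-! ## §1 `L ⊗ ℝ ↪ ℂ^{r₁ + r₂}` and commutative centralisers of regular archimedean elements -/

section Generic

variable (E : Type) [Field E]

/-- The coordinate ring homomorphism `L ⊗_ℚ ℝ = ℝ^{r₁} × ℂ^{r₂} →+* ℂ^{r₁ ⊔ r₂}` (real coordinates through `ℝ ↪ ℂ`) is injective
(plumbing for ★ `Subgroup.mul_comm_of_mem_centralizer_of_charpoly_separable`). [folklore] -/
private theorem mixedSpaceToComplexPi_injective :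
    Function.Injective (RingHom.pi fun i : {w : InfinitePlace E // IsReal w} ⊕ {w : InfinitePlace E // IsComplex w} =>
      (Sum.elim (fun w => Complex.ofRealHom.comp ((Pi.evalRingHom _ w).comp (RingHom.fst _ _)))
        (fun w => (Pi.evalRingHom _ w).comp (RingHom.snd _ _)) i : mixedEmbedding.mixedSpace E →+* ℂ)) := by
  intro x y h
  refine Prod.ext (funext fun w => ?_) (funext fun w => ?_)
  · have hw : ((x.1 w : ℝ) : ℂ) = ((y.1 w : ℝ) : ℂ) := congrFun h (Sum.inl w)
    exact Complex.ofReal_injective hw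
  · exact congrFun h (Sum.inr w)

variable (F : Type) [Field F] [Algebra F E] (c : E ≃ₐ[F] E) (N : ℕ) (J : Matrix (Fin N) (Fin N) E)

/-- **The centraliser of a REGULAR element of `U(J)(E ⊗ ℝ)` is commutative**: `γ ∈ UnitaryGroup.arch F E c N J ≤ GL_N(E ⊗ ℝ)` with separable
characteristic polynomial (★ `IsRegularElt`); any two elements of `U(J)(E ⊗ ℝ)` commuting with `γ` commute (★
`Subgroup.mul_comm_of_mem_centralizer_of_charpoly_separable` through `E ⊗ ℝ ↪ ℂ^{r₁ + r₂}`). [cite: Rogawski1990, §3.1 p. 19] -/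
theorem centralizer_comm_of_isRegularElt_arch (γ : arch F E c N J)
    (hγ : IsRegularElt (γ.val : GL (Fin N) (mixedEmbedding.mixedSpace E))) :
    ∀ a ∈ Subgroup.centralizer ({γ} : Set (arch F E c N J)), ∀ b ∈ Subgroup.centralizer ({γ} : Set (arch F E c N J)), a * b = b * a :=
  Subgroup.mul_comm_of_mem_centralizer_of_charpoly_separable _ (mixedSpaceToComplexPi_injective E) (arch F E c N J) γ hγ

end Generic

end UnitaryGroup

end Literature.NumberTheory.Automorphic

namespace Literature.NumberTheory.Rogawski1990

open Literature.NumberTheory.Automorphic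

/-! ## §2 Admissible archimedean orbital measure families on the regular classes -/

variable (L : Type) [Field L] [NumberField L] [IsCMField L] {N : ℕ}

/-- **Admissible ARCHIMEDEAN orbital measures on the regular classes, given unimodularity.** For `H ∈ M_N(L)` and the real group
`G′_∞ = U(H)(L⁺ ⊗ ℝ) = UnitaryGroup.arch L⁺ L c N H` with `Δ ≡ 1` (`hΔ`; reductive Lie groups are unimodular [Knapp2002, Cor. 8.31] — the
transport of the tree's Cartan-decomposition proof to this carrier is the follow-up brick), and ANY Borel structures on `G′_∞` and on the
orbit quotients `G′_∞ ⧸ (G′_∞)_γ`: there is `m : OrbitalMeasureFamily G′_∞` which is `IsAdmissibleOn` the regular elements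
(`IsRegularElt γ.val`: separable characteristic polynomial over `L ⊗ ℝ`) — non-zero, `G′_∞`-invariant, finite on compacts at every class with
a regular representative (★ `exists_orbitalMeasureFamily_of_forall_comm` + `centralizer_comm_of_isRegularElt_arch`). This is the
measure-existence component of the archimedean transfer statements [Rogawski1990, §14.2 (14.2.1) at `v ∈ S₀`; §14.3 p. 234].
[cite: Rogawski1990, §14.3 p. 234] [cite: DeitmarEchterhoff2014, Thm. 1.5.3] -/
theorem exists_isAdmissibleOn_isRegularElt_arch_of_unimodular (H : Matrix (Fin N) (Fin N) L)
    [MeasurableSpace (UnitaryGroup.arch (↥(maximalRealSubfield L)) L (IsCMField.complexConj L) N H)]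
    [BorelSpace (UnitaryGroup.arch (↥(maximalRealSubfield L)) L (IsCMField.complexConj L) N H)]
    [∀ γ : UnitaryGroup.arch (↥(maximalRealSubfield L)) L (IsCMField.complexConj L) N H,
      MeasurableSpace (UnitaryGroup.arch (↥(maximalRealSubfield L)) L (IsCMField.complexConj L) N H ⧸
        Subgroup.centralizer ({γ} : Set (UnitaryGroup.arch (↥(maximalRealSubfield L)) L (IsCMField.complexConj L) N H)))]
    [∀ γ : UnitaryGroup.arch (↥(maximalRealSubfield L)) L (IsCMField.complexConj L) N H,
      BorelSpace (UnitaryGroup.arch (↥(maximalRealSubfield L)) L (IsCMField.complexConj L) N H ⧸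
        Subgroup.centralizer ({γ} : Set (UnitaryGroup.arch (↥(maximalRealSubfield L)) L (IsCMField.complexConj L) N H)))]
    (hΔ : ∀ g : UnitaryGroup.arch (↥(maximalRealSubfield L)) L (IsCMField.complexConj L) N H, modularCharacterFun g = 1) :
    ∃ m : OrbitalMeasureFamily (UnitaryGroup.arch (↥(maximalRealSubfield L)) L (IsCMField.complexConj L) N H),
      m.IsAdmissibleOn fun γ => IsRegularElt (γ.val : GL (Fin N) (mixedEmbedding.mixedSpace L)) := by
  obtain ⟨m, hm⟩ := exists_orbitalMeasureFamily_of_forall_comm hΔ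
    (fun γ : UnitaryGroup.arch (↥(maximalRealSubfield L)) L (IsCMField.complexConj L) N H =>
      IsRegularElt (γ.val : GL (Fin N) (mixedEmbedding.mixedSpace L)))
    fun γ hγ => UnitaryGroup.centralizer_comm_of_isRegularElt_arch L (↥(maximalRealSubfield L)) (IsCMField.complexConj L) N H γ hγ
  exact ⟨m, fun c hc => ⟨(hm c hc).1, (hm c hc).2.1, (hm c hc).2.2.2⟩⟩

/-- The same with the REGULARITY of the members recorded (`(m c).Regular` at every regular class), as delivered by the engine.
[cite: Rogawski1990, §14.3 p. 234] [cite: DeitmarEchterhoff2014, Thm. 1.5.3] -/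
theorem exists_orbitalMeasureFamily_isRegularElt_arch_of_unimodular (H : Matrix (Fin N) (Fin N) L)
    [MeasurableSpace (UnitaryGroup.arch (↥(maximalRealSubfield L)) L (IsCMField.complexConj L) N H)]
    [BorelSpace (UnitaryGroup.arch (↥(maximalRealSubfield L)) L (IsCMField.complexConj L) N H)]
    [∀ γ : UnitaryGroup.arch (↥(maximalRealSubfield L)) L (IsCMField.complexConj L) N H,
      MeasurableSpace (UnitaryGroup.arch (↥(maximalRealSubfield L)) L (IsCMField.complexConj L) N H ⧸
        Subgroup.centralizer ({γ} : Set (UnitaryGroup.arch (↥(maximalRealSubfield L)) L (IsCMField.complexConj L) N H)))]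
    [∀ γ : UnitaryGroup.arch (↥(maximalRealSubfield L)) L (IsCMField.complexConj L) N H,
      BorelSpace (UnitaryGroup.arch (↥(maximalRealSubfield L)) L (IsCMField.complexConj L) N H ⧸
        Subgroup.centralizer ({γ} : Set (UnitaryGroup.arch (↥(maximalRealSubfield L)) L (IsCMField.complexConj L) N H)))]
    (hΔ : ∀ g : UnitaryGroup.arch (↥(maximalRealSubfield L)) L (IsCMField.complexConj L) N H, modularCharacterFun g = 1) :
    ∃ m : OrbitalMeasureFamily (UnitaryGroup.arch (↥(maximalRealSubfield L)) L (IsCMField.complexConj L) N H),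
      ∀ c : ConjClasses (UnitaryGroup.arch (↥(maximalRealSubfield L)) L (IsCMField.complexConj L) N H),
        IsRegularElt ((Quotient.out c).val : GL (Fin N) (mixedEmbedding.mixedSpace L)) →
          m c ≠ 0 ∧ SMulInvariantMeasure (UnitaryGroup.arch (↥(maximalRealSubfield L)) L (IsCMField.complexConj L) N H)
            (UnitaryGroup.arch (↥(maximalRealSubfield L)) L (IsCMField.complexConj L) N H ⧸
              Subgroup.centralizer ({(Quotient.out c : UnitaryGroup.arch (↥(maximalRealSubfield L)) L (IsCMField.complexConj L) N H)} :
                Set (UnitaryGroup.arch (↥(maximalRealSubfield L)) L (IsCMField.complexConj L) N H))) (m c) ∧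
          (m c).Regular ∧ IsFiniteMeasureOnCompacts (m c) :=
  exists_orbitalMeasureFamily_of_forall_comm hΔ
    (fun γ : UnitaryGroup.arch (↥(maximalRealSubfield L)) L (IsCMField.complexConj L) N H =>
      IsRegularElt (γ.val : GL (Fin N) (mixedEmbedding.mixedSpace L)))
    fun γ hγ => UnitaryGroup.centralizer_comm_of_isRegularElt_arch L (↥(maximalRealSubfield L)) (IsCMField.complexConj L) N H γ hγ

end Literature.NumberTheory.Rogawski1990

end
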